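import Literature.Computability.Complexity.GateEliminationCase7
import Literature.Computability.Complexity.GateEliminationAbsorb
import Literature.Computability.Complexity.GateEliminationOutputTwoVars
import Literature.Computability.Complexity.GateEliminationRule4Sharp

/-!
# Gate elimination: splitting Cases 5–8 of Li–Yang's Theorem 4.1

The named fact `LiYang2022_cases5to8` (`GateEliminationStanding.lean`) is reduced to two named
sub-claims following the printed structure of §4.1 (ECCC TR21-023, pp. 27–40):

* `LiYang2022_case5` — Case 5: "There is an ∧-type gate `G` fed by two `2`-variable `x` and `y`.
  By Case 3, `G` must be a `1`-gate, and hence troubled": the claim for a circuit satisfying the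
  standing assumptions and having a troubled gate.
* `LiYang2022_cases6to8` — Cases 6 and 8 (Case 7 is the tree's `Semicircuit.case7`): "From now
  on, no ∧-type gate is directly fed by two variables. Let `G` be a topologically minimal ∧-type
  gate fed by `I₁` and `I₂` … Clearly `I₁` and `I₂` are computed by a fair cyclic-xor circuit":
  the claim for a circuit satisfying the standing assumptions, without troubled gates and without
  ∧-type gates fed by two variables, at an ∧-type gate `G` outside the xor-part all of whose gate
  inputs lie in the xor-part, which is not in the configuration of Case 7 (a `2`-variable and a
  `1`-gate).

PROVED here: `LiYang2022_cases5to8_of_split` — the two sub-claims imply `LiYang2022_cases5to8`: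
without troubled gates no ∧-type gate is fed by two variables (Cases 3, 4 in `Standing` and
`out_ne_of_var_var`); an ∧-type gate exists (`exists_isAndOp`), hence a topologically minimal one
(`exists_isTopMinAnd`), whose strict ancestors are absorbed into the xor-part (`absorbAnc`,
changing nothing else); the configuration of Case 7 is dispatched to `case7`.

## References

* J. Li, T. Yang, *3.1n − o(n) circuit lower bounds for explicit functions*, STOC 2022;
  ECCC TR21-023, §4.1 (Cases 5–8), Lemma 3.11.
-/

namespace Literature.Computability.Complexity

open Finset

namespace Semicircuit

variable {n : ℕ}

/-- **The conclusion of the one-step claim at the empty packing** (the two branches of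
`LiYang2022_step` / `LiYang2022_cases5to8`). [cite: LiYang2022, Thm. 4.1 (proof), p. 19] -/
def StepGoal (C : Semicircuit n) (f : (Fin n → ZMod 2) → Bool) (R : RdqSource n) (αφ αI αQ : ℝ) : Prop :=
  (∃ (C' : Semicircuit n) (P' : Finset (Fin C'.m × Fin C'.m)),
      C'.Fair ∧ C'.ComputesRestr f R ∧ C'.IsPacking P' ∧ C'.m < C.m ∧
        C'.measure αφ αI αQ P' R ≤ C.measure αφ αI αQ ∅ R) ∨
  (∃ t : ℕ, 1 ≤ t ∧ t ≤ 3 ∧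
    ∃ (C' : Semicircuit n) (R' : RdqSource n) (P' : Finset (Fin C'.m × Fin C'.m)),
      C'.Fair ∧ C'.ComputesRestr f R' ∧ C'.IsPacking P' ∧ R'.dim + t = R.dim ∧
        liYangDelta αφ αI αQ * t ≤ C.measure αφ αI αQ ∅ R - C'.measure αφ αI αQ P' R')

/-- The second branch at the empty packing gives the goal. [folklore] -/
theorem stepGoal_of_stepBranch2 {C : Semicircuit n} {f : (Fin n → ZMod 2) → Bool} {R : RdqSource n} {αφ αI αQ : ℝ}
    (h : C.StepBranch2 f R αφ αI αQ ∅) : C.StepGoal f R αφ αI αQ := Or.inr h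

/-- **The configuration of Case 7** at the ∧-type gate `G`: a `2`-variable and a `1`-gate. [cite: LiYang2022, §4.1 (Case 7)] -/
def Case7Config (C : Semicircuit n) (G : Fin C.m) : Prop :=
  ∃ (a : Fin 2) (x : Fin n) (Q : Fin C.m), C.arg G a = .var x ∧ C.arg G a.rev = .gate Q ∧
    C.fanout (.var x) = 2 ∧ C.fanout (.gate Q) = 1

end Semicircuit

open Semicircuit

/-- **Case 5 of the proof of Thm. 4.1** as a named claim: under the standing assumptions, a
circuit with a troubled gate ("an ∧-type gate `G` fed by two `2`-variable `x` and `y` … a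
`1`-gate, and hence troubled") admits the one-step conclusion at the empty packing.
[cite: LiYang2022, §4.1 (Case 5), Lemma 3.11] -/
def LiYang2022_case5 : Prop :=
  ∀ (αφ αI αQ : ℝ), 0 < αφ → αφ < 1 / 2 → 0 < αI → 0 < αQ →
  ∀ (n d : ℕ) (f : (Fin n → ZMod 2) → Bool), IsAffineDisperser f d →
  ∀ (C : Semicircuit n) (R : RdqSource n), C.Fair → C.ComputesRestr f R → 2 * d + 2 < R.dim → C.Standing R →
  ∀ G : Fin C.m, C.Troubled G → C.StepGoal f R αφ αI αQ

/-- **Cases 6 and 8 of the proof of Thm. 4.1** as a named claim: under the standing assumptions,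
with no troubled gate and no ∧-type gate fed by two variables ("From now on, no ∧-type gate is
directly fed by two variables"), at an ∧-type gate `G` outside the xor-part whose gate inputs lie
in the xor-part ("`G` … topologically minimal … `I₁` and `I₂` are computed by a fair cyclic-xor
circuit") and which is not in the configuration of Case 7, the one-step conclusion holds at the
empty packing (Case 6 treats the protected variables, Case 8 the gate `G`).
[cite: LiYang2022, §4.1 (Cases 6, 8), Lemma 3.11] -/
def LiYang2022_cases6to8 : Prop :=
  ∀ (αφ αI αQ : ℝ), 0 < αφ → αφ < 1 / 2 → 0 < αI → 0 < αQ →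
  ∀ (n d : ℕ) (f : (Fin n → ZMod 2) → Bool), IsAffineDisperser f d →
  ∀ (C : Semicircuit n) (R : RdqSource n), C.Fair → C.ComputesRestr f R → 2 * d + 2 < R.dim → C.Standing R →
  (∀ G, ¬ C.Troubled G) →
  (∀ (G : Fin C.m) (a : Fin 2) (x y : Fin n), IsAndOp (C.op G) → C.arg G a = .var x → C.arg G a.rev = .var y → False) →
  ∀ G : Fin C.m, IsAndOp (C.op G) → G ∉ C.xorPart → (∀ (a : Fin 2) (k : Fin C.m), C.arg G a = .gate k → k ∈ C.xorPart) →
  ¬ C.Case7Config G → C.StepGoal f R αφ αI αQ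

namespace Semicircuit

variable {n : ℕ} {C : Semicircuit n} {f : (Fin n → ZMod 2) → Bool} {R : RdqSource n} {d : ℕ}

/-- A node of out-degree `≥ 2` read at most once by `G` has a reader other than `G`. [folklore] -/
theorem exists_reader_ne {v : Node n C.m} (h2 : 2 ≤ C.fanout v) {G : Fin C.m}
    (hG : (univ.filter fun a : Fin 2 => C.arg G a = v).card ≤ 1) : ∃ (D : Fin C.m) (a : Fin 2), D ≠ G ∧ C.arg D a = v := by
  classical
  by_contra hno
  push Not at hno
  unfold fanout at h2
  have h0 : ∀ k ∈ univ.erase G, (univ.filter fun a : Fin 2 => C.arg k a = v).card = 0 := by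
    intro k hk
    rw [card_eq_zero, filter_eq_empty_iff]
    intro a _ h
    exact hno k a (ne_of_mem_erase hk) h
  have hsum : ∑ k, (univ.filter fun a : Fin 2 => C.arg k a = v).card =
      (univ.filter fun a : Fin 2 => C.arg G a = v).card := by
    rw [← Finset.sum_erase_add _ _ (mem_univ G), sum_eq_zero h0, zero_add]
  rw [hsum] at h2
  omega

/-- **Without troubled gates, no ∧-type gate is fed by two variables** (under the standing
assumptions: by Case 4 both variables have out-degree `≥ 2`, by Case 3 the gate then has
out-degree `≤ 1`; out-degree `0` would make it the output, impossible for a gate fed by two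
variables; out-degree `1` makes it troubled). [cite: LiYang2022, §4.1 (before Case 6)] -/
theorem no_and_two_vars (hf : IsAffineDisperser f d) (hd : 2 * d + 2 < R.dim) (hF : C.Fair)
    (hC : C.ComputesRestr f R) (hS : C.Standing R) (hT : ∀ G, ¬ C.Troubled G)
    {G : Fin C.m} {a : Fin 2} {x y : Fin n} (hand : IsAndOp (C.op G)) (hx : C.arg G a = .var x)
    (hy : C.arg G a.rev = .var y) : False := by
  classical
  have hN := hS.normalized.1
  have hxy : x ≠ y := by
    intro h; subst h
    have e : ∀ a', C.arg G a' = .var x := fun a' => by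
      rcases fin2_eq_or_eq_rev a a' with rfl | rfl
      · exact hx
      · exact hy
    exact hN.arg_zero_ne_arg_one G (by rw [e 0, e 1])
  have hx1 : C.fanout (.var x) ≠ 1 := hS.no_and_one_var G x y a a.rev (fin2_ne_rev a) hx hy hand
  have hy1 : C.fanout (.var y) ≠ 1 := hS.no_and_one_var G y x a.rev a (fin2_ne_rev a).symm hy hx hand
  have hx3 := hS.and_fanout_le x G a hx hand
  have hy3 := hS.and_fanout_le y G a.rev hy hand
  have hxpos : 1 ≤ C.fanout (.var x) := by
    unfold fanout
    refine le_trans ?_ (single_le_sum (f := fun k => (univ.filter fun a' : Fin 2 => C.arg k a' = Node.var x).card)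
      (fun _ _ => Nat.zero_le _) (mem_univ G))
    exact card_pos.mpr ⟨a, mem_filter.mpr ⟨mem_univ _, hx⟩⟩
  have hypos : 1 ≤ C.fanout (.var y) := by
    unfold fanout
    refine le_trans ?_ (single_le_sum (f := fun k => (univ.filter fun a' : Fin 2 => C.arg k a' = Node.var y).card)
      (fun _ _ => Nat.zero_le _) (mem_univ G))
    exact card_pos.mpr ⟨a.rev, mem_filter.mpr ⟨mem_univ _, hy⟩⟩
  -- `G` has positive out-degree (it is not the output)
  have hGpos : 0 < C.fanout (.gate G) := by
    rcases fin2_eq_or_eq_rev 0 a with h0 | h0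
    · subst h0; exact fanout_pos_of_var_var hf (by omega) hF hC hN.out_of_fanout_eq_zero hx hy
    · subst h0
      exact fanout_pos_of_var_var hf (by omega) hF hC hN.out_of_fanout_eq_zero hy hx
  -- hence `G` is troubled
  refine hT G ⟨hand, by omega, x, y, hxy, ?_, by omega, by omega⟩
  ext v
  constructor
  · rintro ⟨a', rfl⟩
    rcases fin2_eq_or_eq_rev a a' with rfl | rfl
    · exact Or.inl hx
    · exact Or.inr hy
  · rintro (rfl | rfl)
    · exact ⟨a, hx⟩
    · exact ⟨a.rev, hy⟩

/-- The goal is unchanged by absorption. [folklore] -/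
theorem stepGoal_absorb_iff (S : Finset (Fin C.m)) (hxor : ∀ k ∈ S, IsXorOp (C.op k))
    (hclosed : ∀ k ∈ S, ∀ (a : Fin 2) (k' : Fin C.m), C.arg k a = .gate k' → k' ∈ C.xorPart ∨ k' ∈ S)
    (αφ αI αQ : ℝ) : (C.absorb S hxor hclosed).StepGoal f R αφ αI αQ ↔ C.StepGoal f R αφ αI αQ := by
  unfold StepGoal
  rw [measure_absorb]

/-- **The split of Cases 5–8**: Case 5, Case 7 (proved), and Cases 6/8 give
`LiYang2022_cases5to8`. [cite: LiYang2022, §4.1 (Cases 5–8)] -/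
theorem LiYang2022_cases5to8_of_split (h5 : LiYang2022_case5) (h68 : LiYang2022_cases6to8) :
    LiYang2022_cases5to8 := by
  intro αφ αI αQ hφ0 hφ hI hQ n d f hf C R hF hC hd hS
  classical
  change C.StepGoal f R αφ αI αQ
  -- Case 5
  by_cases hT : ∃ G, C.Troubled G
  · obtain ⟨G, hG⟩ := hT
    exact h5 αφ αI αQ hφ0 hφ hI hQ n d f hf C R hF hC hd hS G hG
  push Not at hT
  have hno2 : ∀ (G : Fin C.m) (a : Fin 2) (x y : Fin n), IsAndOp (C.op G) → C.arg G a = .var x →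
      C.arg G a.rev = .var y → False := fun G a x y hand hx hy => no_and_two_vars hf hd hF hC hS hT hand hx hy
  -- a topologically minimal ∧-type gate, its strict ancestors absorbed into the xor-part
  obtain ⟨G₀, hG₀⟩ := exists_isAndOp hf (by omega) hF hC
  obtain ⟨G, hG⟩ := C.exists_isTopMinAnd hG₀
  have hand := hG.1
  have hN' := hS.nonDegenerate
  let C₁ := absorbAnc hN' hG
  have hF₁ : C₁.Fair := (C.fair_absorb_iff _ _ _).mpr hF
  have hC₁ : C₁.ComputesRestr f R := (C.computesRestr_absorb_iff _ _ _ f R).mpr hC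
  have hS₁ : C₁.Standing R := C.standing_absorb _ _ _ hS
  have hT₁ : ∀ G', ¬ C₁.Troubled G' := fun G' hT' => hT G' ((C.troubled_absorb_iff _ _ _ G').mp hT')
  have hGK₁ : G ∉ C₁.xorPart := not_mem_xorPart_absorbAnc hN' hG
  have hGin : ∀ (a : Fin 2) (k : Fin C.m), C₁.arg G a = .gate k → k ∈ C₁.xorPart :=
    fun a k h => arg_mem_xorPart_absorbAnc hN' hG h
  rw [← C.stepGoal_absorb_iff (C.strictAncestors G) (isXorOp_of_mem_strictAncestors hN' hG) strictAncestors_closed]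
  change C₁.StepGoal f R αφ αI αQ
  have hN₁ := hS₁.normalized.1
  -- Case 7
  by_cases h7 : C₁.Case7Config G
  · obtain ⟨a, x, Q, hGx, hGQ, hx2, hQ1⟩ := h7
    have hQK : Q ∈ C₁.xorPart := hGin a.rev Q hGQ
    have hQand : ¬ IsAndOp (C₁.op Q) := fun h => IsAndOp.not_isXorOp h (C₁.isXorOp_of_mem Q hQK)
    have hxp : ¬ R.Protected x := fun hp => hS₁.protected_not_and x hp G a hGx hand
    -- `G` is a `1`-gate: not the output, and Case 3
    have hG3 := hS₁.and_fanout_le x G a hGx hand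
    have hG0 : C₁.fanout (.gate G) ≠ 0 := fun h0 =>
      false_of_and_out_reads_var hf (by omega) hF₁ hC₁ (hN₁.out_of_fanout_eq_zero G h0) hand hGx
    have hG1 : C₁.fanout (.gate G) = 1 := by omega
    have hGQ' : G ≠ Q := fun h => hGK₁ (h ▸ hQK)
    -- `x` does not feed `Q` (else `Q` is useless)
    have hQx : ∀ a', C₁.arg Q a' ≠ .var x := by
      intro a' h
      refine hS₁.normalized.2 Q ⟨hQ1, G, a.rev, a', hGQ'.symm, hGQ, ?_⟩
      rw [Fin.rev_rev, hGx, h]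
    have hQout : C₁.out ≠ .gate Q := out_ne_gate_of_mem_xorPart hf (by omega) hF₁ hC₁ hQK
    -- the other reader `D` of `x`, the reader `H` of `G`
    have hGx1 : (univ.filter fun a' : Fin 2 => C₁.arg G a' = .var x).card ≤ 1 := by
      rw [card_le_one]
      intro a₁ ha₁ a₂ ha₂
      rw [mem_filter] at ha₁ ha₂
      have key : ∀ a', C₁.arg G a' = .var x → a' = a := by
        intro a' h
        rcases fin2_eq_or_eq_rev a a' with h' | h'
        · exact h'
        · rw [h', hGQ] at h; cases h
      rw [key a₁ ha₁.2, key a₂ ha₂.2]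
    obtain ⟨D, aD, hDG, hDx⟩ := exists_reader_ne (by omega) hGx1
    obtain ⟨H, aH, hHG⟩ := exists_reader_of_fanout_pos (D := C₁) (by omega : 0 < C₁.fanout (.gate G))
    -- `H` does not read `x` (else `G` is useless)
    have hHG' : H ≠ G := fun h => by rw [h] at hHG; exact C₁.arg_ne_self_of_not_mem hGK₁ aH hHG
    have hHx : ∀ a', C₁.arg H a' ≠ .var x := by
      intro a' h
      have ha' : a' = aH.rev := by
        rcases fin2_eq_or_eq_rev aH a' with rfl | rfl
        · rw [hHG] at h; cases h
        · rfl
      refine hS₁.normalized.2 G ⟨hG1, H, aH, a, hHG'.symm, hHG, ?_⟩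
      rw [← ha', h, hGx]
    exact stepGoal_of_stepBranch2
      (case7 hf hd hF₁ hC₁ C₁.isPacking_empty hφ0.le hI.le αQ hand hGx hGQ hQand hxp hQ1 hQx hQout hDx hDG hHG hHx)
  · -- Cases 6, 8
    exact h68 αφ αI αQ hφ0 hφ hI hQ n d f hf C₁ R hF₁ hC₁ hd hS₁ hT₁ hno2 G hand hGK₁ hGin h7

end Semicircuit

end Literature.Computability.Complexity
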